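import Literature.Topology.Immersions.NormalEulerClass
import Literature.Topology.Immersions.ProjBundleOrientationPullback
import Literature.AlgebraicTopology.CharacteristicClasses.FibrewiseContinuity
import HarnessLib

/-!
# Naturality of the Euler class of an oriented plane bundle under pull-back

Topic `Literature/Topology/Immersions`. For an oriented rank-`2` projection-field bundle
`(E, o)` over `M` and a `C^∞` map `φ : N → M`, the pulled-back bundle `φ^*E`
(`ProjBundle.pullback`, `ProjBundleBasic.lean`) with the pulled-back orientation `o ∘ φ`
(`ProjBundleOrientationPullback.lean`) has Euler class

  `e(φ^*E, o ∘ φ) = φ^* e(E, o) ∈ H²(N; ℤ)`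

(`ProjBundle.eulerClassOf_pullback`; Milnor–Stasheff, *Characteristic Classes* (1974), §9
Property 9.2 / Husemoller (C₁) Prop. 17.3.3: naturality). Proof: the bundle charts of `φ^*E` at
`y₀` ARE the charts of `E` at `φ y₀` read along `φ` (`pullback_frameAt`, definitional), so the
complex line cores have the same transition coefficients (`lineCoeff_pullback`); hence the
identity on fibres is a bundle map `lineCore (φ^*E) → lineCore E` over `φ` (continuous by the
tree's `VectorBundleCore.continuous_totalSpace_map`), i.e. an isomorphism
`lineCore (φ^*E) ≅ φ^*(lineCore E)` with Mathlib's pull-back bundle, and the tree's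
`eulerClass_iso`, `eulerClass_pullback` (`LineEulerClass.lean`) conclude.

Everything here is proved; no definitions, no named facts.

## References

* J. Milnor, J. Stasheff, *Characteristic Classes* (1974), §9 Property 9.2, §14.
  [MilnorStasheff1974]
* D. Husemoller, *Fibre Bundles*, 3rd ed. (1994), Ch. 17 Prop. 3.3. [HusemollerFibreBundles1994]
-/

open scoped Manifold ContDiff Topology
open Set Function Module Filter Bundle

noncomputable section

namespace Literature.Topology.Immersions

/-- Local notation: `𝔼 n` is the model Euclidean space `EuclideanSpace ℝ (Fin n)`. -/
local notation "𝔼 " n:arg => EuclideanSpace ℝ (Fin n)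

open Literature.AlgebraicTopology.CharacteristicClasses (eulerClass eulerClass_iso eulerClass_pullback)
open Literature.AlgebraicTopology.SingularHomology (singularCohomology)

namespace ProjBundle

variable {n n' m : ℕ} {M : Type*} [TopologicalSpace M] [ChartedSpace (𝔼 n) M]
  {N : Type*} [TopologicalSpace N] [ChartedSpace (𝔼 n') N]
  (P : ProjBundle n m 2 M) (o : ∀ x, Orientation ℝ (P.fibre x) (Fin 2))
  (φ : N → M) (hφ : ContMDiff (𝓡 n') (𝓡 n) ∞ φ)

/-- **The transition coefficients of `φ^*E` are those of `E` along `φ`.** [folklore] -/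
theorem lineCoeff_pullback (y₀ y₁ y : N) :
    (P.pullback φ hφ).lineCoeff (fun y => o (φ y)) y₀ y₁ y = P.lineCoeff o (φ y₀) (φ y₁) (φ y) := rfl

variable {P o φ hφ}

/-- **The identity on fibres is a continuous bundle map `lineCore (φ^*E) → lineCore E` over `φ`.**
[cite: HusemollerFibreBundles1994, Ch. 5 §2] -/
theorem continuous_lineCore_pullback_map (ho : P.IsOrientation o) :
    Continuous fun q : ((P.pullback φ hφ).lineCore (fun y => o (φ y)) (ho.pullback φ hφ)).TotalSpace =>
      (⟨φ q.proj, q.2⟩ : (P.lineCore o ho).TotalSpace) := by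
  refine ((P.pullback φ hφ).lineCore (fun y => o (φ y)) (ho.pullback φ hφ)).continuous_totalSpace_map
    (P.lineCore o ho) hφ.continuous (fun _ v => v) fun y₀ v => ?_
  -- the local expression is the identity near `y₀`
  have hS : φ ⁻¹' (P.obaseSet o (φ y₀)) ∩ (P.pullback φ hφ).obaseSet (fun y => o (φ y)) y₀ ∈ 𝓝 y₀ :=
    inter_mem (hφ.continuous.continuousAt.preimage_mem_nhds
      ((P.isOpen_obaseSet o (φ y₀)).mem_nhds (mem_obaseSet_self ho (φ y₀))))
      (((P.pullback φ hφ).isOpen_obaseSet _ y₀).mem_nhds (mem_obaseSet_self (ho.pullback φ hφ) y₀))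
  refine (continuousAt_snd (p := (y₀, v))).congr ?_
  filter_upwards [prod_mem_nhds hS (univ_mem (f := 𝓝 v))] with q hq
  obtain ⟨⟨hq₁, hq₂⟩, -⟩ := hq
  show q.2 = (P.lineCore o ho).coordChange (φ q.1) (φ y₀) (φ q.1)
    (((P.pullback φ hφ).lineCore (fun y => o (φ y)) (ho.pullback φ hφ)).coordChange y₀ q.1 q.1 q.2)
  rw [lineCore_coordChange, lineCore_coordChange, lineCoeff_pullback, ← mul_assoc]
  -- `c(φ q, φ y₀) * c(φ y₀, φ q) = 1` at `φ q`
  have hq₂' : φ q.1 ∈ P.obaseSet o (φ y₀) := hq₁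
  have hself : φ q.1 ∈ P.obaseSet o (φ q.1) := mem_obaseSet_self ho _
  rw [lineCoeff_comp hq₂' hself hq₂', lineCoeff_self hq₂', one_mul]

/-! ### Naturality of the Euler class -/

variable {M : Type} [TopologicalSpace M] [T2Space M] [ParacompactSpace M] [ChartedSpace (𝔼 n) M]
  {N : Type} [TopologicalSpace N] [T2Space N] [ParacompactSpace N] [ChartedSpace (𝔼 n') N]
  {P : ProjBundle n m 2 M} {o : ∀ x, Orientation ℝ (P.fibre x) (Fin 2)}
  {φ : N → M} {hφ : ContMDiff (𝓡 n') (𝓡 n) ∞ φ}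

/-- **Naturality: `e(φ^*E, o ∘ φ) = φ^* e(E, o)`.**
[cite: MilnorStasheff1974, §9 Property 9.2; HusemollerFibreBundles1994, Ch. 17 Prop. 3.3] -/
theorem eulerClassOf_pullback (ho : P.IsOrientation o) :
    (P.pullback φ hφ).eulerClassOf (fun y => o (φ y)) (ho.pullback φ hφ) =
      singularCohomology.map ℤ ℤ (⟨φ, hφ.continuous⟩ : C(N, M)) 2 (P.eulerClassOf o ho) := by
  set f : C(N, M) := ⟨φ, hφ.continuous⟩
  -- `lineCore (φ^*E) ≅ φ^*(lineCore E)` via the identity on fibres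
  have hcont : Continuous fun q :
      ((P.pullback φ hφ).lineCore (fun y => o (φ y)) (ho.pullback φ hφ)).TotalSpace =>
      (⟨(ContinuousMap.id N) q.proj, (ContinuousLinearEquiv.refl ℂ ℂ) q.2⟩ :
        TotalSpace ℂ (⇑f *ᵖ (P.lineCore o ho).Fiber)) := by
    rw [(inducing_pullbackTotalSpaceEmbedding ℂ (P.lineCore o ho).Fiber ⇑f).continuous_iff]
    exact (FiberBundle.continuous_proj ℂ _).prodMk (continuous_lineCore_pullback_map ho)
  have hiso := eulerClass_iso ℂ ((P.pullback φ hφ).lineCore (fun y => o (φ y)) (ho.pullback φ hφ)).Fiber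
    finrank_complex_self ℤ ℂ (⇑f *ᵖ (P.lineCore o ho).Fiber) finrank_complex_self
    (fun _ => ContinuousLinearEquiv.refl ℂ ℂ) hcont 1
  rw [eulerClassOf, hiso, eulerClass_pullback]
  rfl

end ProjBundle

end Literature.Topology.Immersions
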